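import Mathlib
import Summits.Ventures.PercRepro2.SwOutCrossJunctionRead
import Summits.Ventures.PercRepro2.SwOutCrossBaseBlockM

/-!
# The block of a core-kind class point satisfies the rigid inequality, for ANY cross graph whose
record has the inequality (blind cell PercRepro2, night-4 g25, 2026-08-28; proofs/NIGHT4-G25.md §4)

`card_blockX_le` of `SwOutCrossJunctionRead` with the block theorem `rigid_block_crossM` in place
of `rigid_block_cross`: the hypothesis is the abstract inequality `IneqM (fibKEEMin G) ι` of the
record of the cross graph, for every finite non-empty u-arm type `ι` (the u-arms of the base read
off the point are a subtype of `Set V`, hence the universe of `V`).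
-/

namespace Summit.Ventures.PercRepro2

namespace CrossArm

open Hull LocRows

universe uV

variable {V : Type uV} {E : Type*} [Fintype E] [DecidableEq E]

open scoped Classical

variable {ends : E → Sym2 V} {X : Type*} [Fintype X] {U : Set V} {ξ : Config E} {l h o u : V}
  {p : X → V} {G : SimpleGraph X} [DecidableRel G.Adj]

/-- The inequality of the record of `G` over every u-arm type read off a base: a non-empty
finite family of vertex sets of `V`. -/
def IneqAll (G : SimpleGraph X) (V : Type uV) : Prop :=
  ∀ (S : Finset (Set V)) [Fintype {P // P ∈ S}] [DecidableEq {P // P ∈ S}] [Nonempty {P // P ∈ S}]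
    [Fintype (FibKE X G)] [DecidableEq (FibKE X G)], IneqM (fibKEEMin G) (ι := {P // P ∈ S})

variable (hj : CrossJunction ends U h u p G o) (hl : l ∉ U) {ζ : Config E}
  (hζ : ζ ∈ swOutSide ends l h o U ξ) (hk : CoreKind ends U h u ζ)
include hj hl hζ hk

/-- **The block of a core-kind class point satisfies the rigid inequality**, for any cross graph
whose record has the inequality (`rigid_block_crossM`). -/
theorem CrossJunction.card_blockX_le' (hineq : IneqAll G V) {𝓔 : Set (Set E)}
    (h𝓔 : IsUpperSet 𝓔) :
    ((blockX ends h u p G (baseX ends h u p ζ)).filter fun ζ' =>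
        ζ' ∈ tgtU ends l h {S : Set V | o ∈ S} ∧ redEdges ends ζ' h ∈ 𝓔).card ≤
      ((blockX ends h u p G (baseX ends h u p ζ)).filter fun ζ' =>
        ζ' ∈ tgtU ends l h {S : Set V | o ∈ S} ∧ blueEdges ends ζ' h ∈ 𝓔).card := by
  haveI := hj.nonempty_ιX hl hζ hk
  have hb := hj.crossBase_of_coreKind hl hζ hk
  have hlstr : l ∉ strX h u (UX ends h u p (baseX ends h u p ζ)) p (FX ends h u p (baseX ends h u p ζ)) :=
    fun hl' => hl (hj.strX_subset_U hl hζ hk hl')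
  exact hb.rigid_block_crossM (hineq _) hj.hup hj.hcross (hj.exists_clsCX) (hj.hFe_baseX hl hζ hk)
    hj.exists_clsExtX hlstr hj.hou hj.hop h𝓔

end CrossArm

end Summit.Ventures.PercRepro2
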